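import Mathlib
import HarnessLib
import Literature.Probability.Percolation.CornerPercolation
import Literature.Barriers.CriticalPhenomena.EmbeddingModulusUniqueness
import Literature.Analysis.Complex.VitaliConvergence

/-!
# Crux `SegmentOpen` (stmt-CriticalPhenomena-5471), line `Sketch` — stub `stub_vitaliTransfer`

Worker file. The theorem name, namespace, `open` lines and the statement text are EXACTLY those
registered by the lead's skeleton (`work/SegmentOpen.lean`, `Cruxes/SegmentOpen/Lines/Sketch.lean`);
do not change them. Helper lemmas: `private`, above the theorem, each with a docstring.
-/

noncomputable section

namespace Summit.CriticalPhenomena.CardyFormulaZ2.Theorems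

open Literature.Probability Literature.Barriers.CriticalPhenomena
open Literature.Probability.RandomPlanarGeometry (ConformalRectangle ConformalEquiv MarkedDomain)
open Filter Set Topology

/-! ### Helpers: the real axis inside the complex disc -/

/-- The embedding `ℝ → ℂ` is an isometry: real points at distance `< r` stay at distance `< r`. -/
private theorem dist_ofReal_lt {c s r : ℝ} (h : dist s c < r) : dist (s : ℂ) (c : ℂ) < r :=
  (Complex.isometry_ofReal.dist_eq s c).trans_lt h

/-- A parameter `t` of the unit interval with `dist t t₀ < r` gives a point `↑↑t` of the complex
disc `ball ↑↑t₀ r`. -/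
private theorem ofReal_val_mem_ball {t₀ t : unitInterval} {r : ℝ} (ht : dist t t₀ < r) :
    ((t : ℝ) : ℂ) ∈ Metric.ball ((t₀ : ℝ) : ℂ) r :=
  Metric.mem_ball.2 (dist_ofReal_lt ((Subtype.dist_eq t t₀).symm.trans_lt ht))

/-- The parameters `u n ≠ t₀`, `u n → t₀`, viewed in `ℂ`, tend to `↑↑t₀` within the punctured
plane. -/
private theorem tendsto_ofReal_val_nhdsNE {t₀ : unitInterval} {u : ℕ → unitInterval}
    (hu : Tendsto u atTop (𝓝 t₀)) (hne : ∀ n, u n ≠ t₀) :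
    Tendsto (fun n => ((u n : ℝ) : ℂ)) atTop (𝓝[≠] ((t₀ : ℝ) : ℂ)) := by
  refine tendsto_nhdsWithin_iff.2 ⟨?_, Eventually.of_forall fun n => ?_⟩
  · exact ((Complex.continuous_ofReal.comp continuous_subtype_val).tendsto t₀).comp hu
  · rw [mem_compl_iff, mem_singleton_iff]
    exact fun h => hne n (Subtype.ext (Complex.ofReal_injective h))

/-- The points `↑↑(u n)` with `dist (u n) t₀ < r` accumulate at `↑↑t₀`, as a `Filter.Frequently`
statement on the punctured neighbourhood filter. -/
private theorem frequently_eq_ofReal_val {t₀ : unitInterval} {u : ℕ → unitInterval}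
    (hu : Tendsto u atTop (𝓝 t₀)) (hne : ∀ n, u n ≠ t₀) {r : ℝ} (hr : 0 < r) :
    ∃ᶠ z in 𝓝[≠] ((t₀ : ℝ) : ℂ), ∃ n, dist (u n) t₀ < r ∧ z = ((u n : ℝ) : ℂ) := by
  have hev : ∀ᶠ n in atTop, dist (u n) t₀ < r := Metric.tendsto_nhds.1 hu r hr
  refine (tendsto_ofReal_val_nhdsNE hu hne).frequently ?_
  exact (hev.mono fun n hn => ⟨n, hn, rfl⟩).frequently

/-! ### Helpers: Vitali along sequences of meshes, and the subsequence principle -/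

/-- **Vitali's theorem along one sequence of meshes** `d k → 0⁺`: the holomorphic, uniformly
bounded functions `f (d k)` converge locally uniformly on the disc to a holomorphic `G`, and `G`
takes the value `L n` at every admissible `↑↑(u n)`. -/
private theorem exists_limit_along_seq {t₀ : unitInterval} {r : ℝ} (hr : 0 < r) {C : ℝ}
    {f : ℝ → ℂ → ℂ} (hfd : ∀ δ, DifferentiableOn ℂ (f δ) (Metric.ball ((t₀ : ℝ) : ℂ) r))
    (hfb : ∀ δ, ∀ z ∈ Metric.ball ((t₀ : ℝ) : ℂ) r, ‖f δ z‖ ≤ C)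
    {u : ℕ → unitInterval} (hu : Tendsto u atTop (𝓝 t₀)) (hne : ∀ n, u n ≠ t₀)
    {L : ℕ → ℂ} (hL : ∀ n, dist (u n) t₀ < r →
      Tendsto (fun δ => f δ ((u n : ℝ) : ℂ)) (𝓝[>] 0) (𝓝 (L n)))
    {d : ℕ → ℝ} (hd : Tendsto d atTop (𝓝[>] 0)) :
    ∃ G : ℂ → ℂ, DifferentiableOn ℂ G (Metric.ball ((t₀ : ℝ) : ℂ) r) ∧
      TendstoLocallyUniformlyOn (fun k => f (d k)) G atTop (Metric.ball ((t₀ : ℝ) : ℂ) r) ∧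
      ∀ n, dist (u n) t₀ < r → G ((u n : ℝ) : ℂ) = L n := by
  have hUo : IsOpen (Metric.ball ((t₀ : ℝ) : ℂ) r) := Metric.isOpen_ball
  have hUc : IsPreconnected (Metric.ball ((t₀ : ℝ) : ℂ) r) := (convex_ball _ _).isPreconnected
  have ht₀U : ((t₀ : ℝ) : ℂ) ∈ Metric.ball ((t₀ : ℝ) : ℂ) r := Metric.mem_ball_self hr
  -- pointwise convergence at the admissible `↑↑(u n)`
  have hpt : ∀ n, dist (u n) t₀ < r →
      Tendsto (fun k => f (d k) ((u n : ℝ) : ℂ)) atTop (𝓝 (L n)) :=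
    fun n hn => (hL n hn).comp hd
  have hS : ∃ᶠ z in 𝓝[≠] ((t₀ : ℝ) : ℂ), ∃ c : ℂ, Tendsto (fun k => f (d k) z) atTop (𝓝 c) :=
    (frequently_eq_ofReal_val hu hne hr).mono fun z hz => by
      obtain ⟨n, hn, rfl⟩ := hz
      exact ⟨L n, hpt n hn⟩
  obtain ⟨G, hG, hlim⟩ :=
    Literature.Analysis.Complex.exists_tendstoLocallyUniformlyOn_of_frequently_tendsto hUo hUc
      (F := fun k => f (d k)) (fun k => hfd (d k))
      (fun a _ => ⟨C, 1, one_pos, fun k z hz => hfb (d k) z hz.2⟩) ht₀U hS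
  exact ⟨G, hG, hlim, fun n hn =>
    tendsto_nhds_unique (hlim.tendsto_at (ofReal_val_mem_ball hn)) (hpt n hn)⟩

/-- **Identity theorem**: two holomorphic functions on the disc taking the values `L n` at the
admissible `↑↑(u n)` (which accumulate at the centre) coincide on the disc. -/
private theorem eqOn_of_eq_at_params {t₀ : unitInterval} {r : ℝ} (hr : 0 < r)
    {u : ℕ → unitInterval} (hu : Tendsto u atTop (𝓝 t₀)) (hne : ∀ n, u n ≠ t₀) {L : ℕ → ℂ}
    {G G' : ℂ → ℂ} (hG : DifferentiableOn ℂ G (Metric.ball ((t₀ : ℝ) : ℂ) r))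
    (hG' : DifferentiableOn ℂ G' (Metric.ball ((t₀ : ℝ) : ℂ) r))
    (hGL : ∀ n, dist (u n) t₀ < r → G ((u n : ℝ) : ℂ) = L n)
    (hG'L : ∀ n, dist (u n) t₀ < r → G' ((u n : ℝ) : ℂ) = L n) :
    EqOn G G' (Metric.ball ((t₀ : ℝ) : ℂ) r) := by
  have hUo : IsOpen (Metric.ball ((t₀ : ℝ) : ℂ) r) := Metric.isOpen_ball
  have hfreq : ∃ᶠ z in 𝓝[≠] ((t₀ : ℝ) : ℂ), G z = G' z :=
    (frequently_eq_ofReal_val hu hne hr).mono fun z hz => by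
      obtain ⟨n, hn, rfl⟩ := hz
      rw [hGL n hn, hG'L n hn]
  exact (hG.analyticOnNhd hUo).eqOn_of_preconnected_of_frequently_eq (hG'.analyticOnNhd hUo)
    (convex_ball _ _).isPreconnected (Metric.mem_ball_self hr) hfreq

/-- **The subsequence principle**: convergence along every sequence of meshes, to limits that
agree by the identity theorem, gives convergence along the filter `𝓝[>] 0` on the whole disc to
one holomorphic function. -/
private theorem exists_limit {t₀ : unitInterval} {r : ℝ} (hr : 0 < r) {C : ℝ}
    {f : ℝ → ℂ → ℂ} (hfd : ∀ δ, DifferentiableOn ℂ (f δ) (Metric.ball ((t₀ : ℝ) : ℂ) r))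
    (hfb : ∀ δ, ∀ z ∈ Metric.ball ((t₀ : ℝ) : ℂ) r, ‖f δ z‖ ≤ C)
    {u : ℕ → unitInterval} (hu : Tendsto u atTop (𝓝 t₀)) (hne : ∀ n, u n ≠ t₀)
    {L : ℕ → ℂ} (hL : ∀ n, dist (u n) t₀ < r →
      Tendsto (fun δ => f δ ((u n : ℝ) : ℂ)) (𝓝[>] 0) (𝓝 (L n))) :
    ∃ G : ℂ → ℂ, DifferentiableOn ℂ G (Metric.ball ((t₀ : ℝ) : ℂ) r) ∧
      ∀ z ∈ Metric.ball ((t₀ : ℝ) : ℂ) r, Tendsto (fun δ => f δ z) (𝓝[>] 0) (𝓝 (G z)) := by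
  obtain ⟨d₀, hd₀⟩ := Filter.exists_seq_tendsto (𝓝[>] (0 : ℝ))
  obtain ⟨G, hG, -, hGL⟩ := exists_limit_along_seq hr hfd hfb hu hne hL hd₀
  refine ⟨G, hG, fun z hz => tendsto_iff_seq_tendsto.2 fun d hd => ?_⟩
  obtain ⟨G', hG', hlim', hG'L⟩ := exists_limit_along_seq hr hfd hfb hu hne hL hd
  have heq : G' z = G z := eqOn_of_eq_at_params hr hu hne hG' hG hG'L hGL hz
  have h := hlim'.tendsto_at hz
  rw [heq] at h
  simpa [Function.comp_def] using h

/-- The real part of a holomorphic function on the complex disc `ball ↑c r`, restricted to the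
real axis, is real-analytic on the real interval `ball c r`. -/
private theorem analyticOnNhd_re_comp_ofReal {c r : ℝ} {G : ℂ → ℂ}
    (hG : DifferentiableOn ℂ G (Metric.ball (c : ℂ) r)) :
    AnalyticOnNhd ℝ (fun s : ℝ => (G s).re) (Metric.ball c r) := by
  intro s hs
  have hsU : (s : ℂ) ∈ Metric.ball (c : ℂ) r := Metric.mem_ball.2 (dist_ofReal_lt hs)
  have hGa : AnalyticAt ℝ G s :=
    (hG.analyticAt (Metric.isOpen_ball.mem_nhds hsU)).restrictScalars
  have h1 : AnalyticAt ℝ (fun x : ℝ => G x) s := by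
    have h := hGa.comp_of_eq (Complex.ofRealCLM.analyticAt s) (Complex.ofRealCLM_apply s)
    simpa [Function.comp_def] using h
  have h2 := (Complex.reCLM.analyticAt (G s)).comp_of_eq h1 rfl
  simpa [Function.comp_def] using h2

/-- S2 (M/L). VITALI TRANSFER at every `(t₀, R)`: under weak uniform analyticity near `t₀` (one
complex radius `r`, for every `R` a bound `C` uniform in the mesh, holomorphic extensions `f` of
`t ↦ P_t(R, δ)`), convergence of `P_·(R, δ)` as `δ → 0⁺` along a sequence `t_n → t₀`, `t_n ≠ t₀`
gives convergence at every parameter near `t₀`, to a real-analytic limit. From the tree's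
`Literature.Analysis.Complex.exists_tendstoLocallyUniformlyOn_of_frequently_tendsto` (sequences)
plus `Filter.tendsto_iff_seq_tendsto` for the filter `𝓝[>] 0`. -/
theorem stub_vitaliTransfer :
    ∀ (t₀ : unitInterval) (R : ConformalRectangle),
      (∃ r > 0, ∀ R : ConformalRectangle, ∃ C : ℝ, ∀ δ : ℝ, 0 < δ →
        ∃ f : ℂ → ℂ, DifferentiableOn ℂ f (Metric.ball ((t₀ : ℝ) : ℂ) r) ∧
          (∀ z ∈ Metric.ball ((t₀ : ℝ) : ℂ) r, ‖f z‖ ≤ C) ∧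
          ∀ t : unitInterval, dist t t₀ < r →
            f ((t : ℝ) : ℂ) = Percolation.cornerCrossingProb t R δ) →
      (∃ u : ℕ → unitInterval, Tendsto u atTop (𝓝 t₀) ∧ (∀ n, u n ≠ t₀) ∧
        ∀ n, ∃ L : ℝ, Tendsto (Percolation.cornerCrossingProb (u n) R) (𝓝[>] 0) (𝓝 L)) →
      ∃ r > 0, ∃ g : ℝ → ℝ, AnalyticOnNhd ℝ g (Metric.ball (t₀ : ℝ) r) ∧
        ∀ t : unitInterval, dist t t₀ < r →
          Tendsto (Percolation.cornerCrossingProb t R) (𝓝[>] 0) (𝓝 (g t)) := by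
  intro t₀ R hUA hconv
  obtain ⟨r, hr, hUA⟩ := hUA
  obtain ⟨C, hC⟩ := hUA R
  obtain ⟨u, hu, hne, hLex⟩ := hconv
  choose L hL using hLex
  choose f₀ hf₀d hf₀b hf₀v using hC
  -- a family of holomorphic functions, defined for every real `δ`, uniformly bounded on the disc,
  -- extending `t ↦ P_t(R, δ)` for `δ > 0`
  obtain ⟨f, hfd, hfb, hfv⟩ : ∃ f : ℝ → ℂ → ℂ,
      (∀ δ, DifferentiableOn ℂ (f δ) (Metric.ball ((t₀ : ℝ) : ℂ) r)) ∧
      (∀ δ, ∀ z ∈ Metric.ball ((t₀ : ℝ) : ℂ) r, ‖f δ z‖ ≤ C) ∧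
      ∀ δ, 0 < δ → ∀ t : unitInterval, dist t t₀ < r →
        f δ ((t : ℝ) : ℂ) = (Percolation.cornerCrossingProb t R δ : ℂ) := by
    refine ⟨fun δ => if h : 0 < δ then f₀ δ h else f₀ 1 one_pos, fun δ => ?_, fun δ z hz => ?_,
      fun δ hδ t ht => ?_⟩
    · by_cases h : 0 < δ
      · simp only [dif_pos h]; exact hf₀d δ h
      · simp only [dif_neg h]; exact hf₀d 1 one_pos
    · by_cases h : 0 < δ
      · simp only [dif_pos h]; exact hf₀b δ h z hz
      · simp only [dif_neg h]; exact hf₀b 1 one_pos z hz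
    · simp only [dif_pos hδ]; exact hf₀v δ hδ t ht
  -- on `𝓝[>] 0` the meshes are positive
  have hpos : ∀ᶠ δ in 𝓝[>] (0 : ℝ), 0 < δ := eventually_mem_nhdsWithin
  -- pointwise convergence at the admissible `↑↑(u n)`, in `ℂ`
  have hLc : ∀ n, dist (u n) t₀ < r →
      Tendsto (fun δ => f δ ((u n : ℝ) : ℂ)) (𝓝[>] 0) (𝓝 ((L n : ℝ) : ℂ)) := fun n hn =>
    ((Complex.continuous_ofReal.tendsto _).comp (hL n)).congr'
      (hpos.mono fun δ hδ => (hfv δ hδ (u n) hn).symm)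
  obtain ⟨G, hG, hGlim⟩ := exists_limit hr hfd hfb hu hne hLc
  refine ⟨r, hr, fun s => (G s).re, analyticOnNhd_re_comp_ofReal hG, fun t ht => ?_⟩
  have h1 : Tendsto (fun δ => (f δ ((t : ℝ) : ℂ)).re) (𝓝[>] 0) (𝓝 (G ((t : ℝ) : ℂ)).re) :=
    (Complex.continuous_re.tendsto _).comp (hGlim _ (ofReal_val_mem_ball ht))
  refine h1.congr' (hpos.mono fun δ hδ => ?_)
  simp only [hfv δ hδ t ht, Complex.ofReal_re]

/-- S2' (reshape of S2 for line `Sketch`, registered stub `stub_vitaliTransferUniform`). VITALI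
TRANSFER WITH UNIFORM RADIUS: if, for every mesh `δ > 0`, `t ↦ P_t(R, δ)` is the restriction of a
holomorphic function on the complex disc of radius `r` around `t₀`, bounded by `C` uniformly in
`δ`, and `P_·(R, δ)` converges as `δ → 0⁺` at parameters `t_n → t₀`, `t_n ≠ t₀`, then it converges
at EVERY parameter of the real disc of the SAME radius `r`, to a real-analytic limit (so that in the
line's accumulation step one radius serves all conformal rectangles). Same proof as
`stub_vitaliTransfer`, which already produced this radius. Vitali 1903 / Porter 1904;
Titchmarsh, *The Theory of Functions*, §5.21. -/
theorem stub_vitaliTransferUniform :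
    ∀ (t₀ : unitInterval) (R : ConformalRectangle) (r : ℝ), 0 < r →
      (∃ C : ℝ, ∀ δ : ℝ, 0 < δ →
        ∃ f : ℂ → ℂ, DifferentiableOn ℂ f (Metric.ball ((t₀ : ℝ) : ℂ) r) ∧
          (∀ z ∈ Metric.ball ((t₀ : ℝ) : ℂ) r, ‖f z‖ ≤ C) ∧
          ∀ t : unitInterval, dist t t₀ < r →
            f ((t : ℝ) : ℂ) = Percolation.cornerCrossingProb t R δ) →
      (∃ u : ℕ → unitInterval, Tendsto u atTop (𝓝 t₀) ∧ (∀ n, u n ≠ t₀) ∧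
        ∀ n, ∃ L : ℝ, Tendsto (Percolation.cornerCrossingProb (u n) R) (𝓝[>] 0) (𝓝 L)) →
      ∃ g : ℝ → ℝ, AnalyticOnNhd ℝ g (Metric.ball (t₀ : ℝ) r) ∧
        ∀ t : unitInterval, dist t t₀ < r →
          Tendsto (Percolation.cornerCrossingProb t R) (𝓝[>] 0) (𝓝 (g t)) := by
  intro t₀ R r hr hC hconv
  obtain ⟨C, hC⟩ := hC
  obtain ⟨u, hu, hne, hLex⟩ := hconv
  choose L hL using hLex
  choose f₀ hf₀d hf₀b hf₀v using hC
  -- a family of holomorphic functions, defined for every real `δ`, uniformly bounded on the disc,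
  -- extending `t ↦ P_t(R, δ)` for `δ > 0`
  obtain ⟨f, hfd, hfb, hfv⟩ : ∃ f : ℝ → ℂ → ℂ,
      (∀ δ, DifferentiableOn ℂ (f δ) (Metric.ball ((t₀ : ℝ) : ℂ) r)) ∧
      (∀ δ, ∀ z ∈ Metric.ball ((t₀ : ℝ) : ℂ) r, ‖f δ z‖ ≤ C) ∧
      ∀ δ, 0 < δ → ∀ t : unitInterval, dist t t₀ < r →
        f δ ((t : ℝ) : ℂ) = (Percolation.cornerCrossingProb t R δ : ℂ) := by
    refine ⟨fun δ => if h : 0 < δ then f₀ δ h else f₀ 1 one_pos, fun δ => ?_, fun δ z hz => ?_,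
      fun δ hδ t ht => ?_⟩
    · by_cases h : 0 < δ
      · simp only [dif_pos h]; exact hf₀d δ h
      · simp only [dif_neg h]; exact hf₀d 1 one_pos
    · by_cases h : 0 < δ
      · simp only [dif_pos h]; exact hf₀b δ h z hz
      · simp only [dif_neg h]; exact hf₀b 1 one_pos z hz
    · simp only [dif_pos hδ]; exact hf₀v δ hδ t ht
  have hpos : ∀ᶠ δ in 𝓝[>] (0 : ℝ), 0 < δ := eventually_mem_nhdsWithin
  have hLc : ∀ n, dist (u n) t₀ < r →
      Tendsto (fun δ => f δ ((u n : ℝ) : ℂ)) (𝓝[>] 0) (𝓝 ((L n : ℝ) : ℂ)) := fun n hn =>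
    ((Complex.continuous_ofReal.tendsto _).comp (hL n)).congr'
      (hpos.mono fun δ hδ => (hfv δ hδ (u n) hn).symm)
  obtain ⟨G, hG, hGlim⟩ := exists_limit hr hfd hfb hu hne hLc
  refine ⟨fun s => (G s).re, analyticOnNhd_re_comp_ofReal hG, fun t ht => ?_⟩
  have h1 : Tendsto (fun δ => (f δ ((t : ℝ) : ℂ)).re) (𝓝[>] 0) (𝓝 (G ((t : ℝ) : ℂ)).re) :=
    (Complex.continuous_re.tendsto _).comp (hGlim _ (ofReal_val_mem_ball ht))
  refine h1.congr' (hpos.mono fun δ hδ => ?_)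
  simp only [hfv δ hδ t ht, Complex.ofReal_re]

end Summit.CriticalPhenomena.CardyFormulaZ2.Theorems
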